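import Summits.ABC.StewartYu.PadicG3TwoFrameAssembly
import Summits.ABC.StewartYu.PadicG3TwoBoxes
import HarnessLib

/-!
# Cell abc-stewartyu, Gen-3 frame at `p = 2` (crux `Y07Two`, stmt-ABC-19659), level 0: the ADMISSIBILITY FIELDS of
# the Fel'dman family `i = (ℓ₀, (u, u_θ)) ↦ (Δ(Y₀; ℓ₀, H), u, u_θ)` on the box — in the shapes of p5-g3's `G3Adm`

`Summits/ABC/StewartYu/PadicG3TwoFeldmanAdm.lean` — cell `abc-stewartyu` (HOME `run/shared/lean/pub/abc-stewartyu/`),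
route `PadicPrimesKummerThird`, seat p3 (g5), F-two LEAD.  Theorems only; decoupled from `PadicG3TwoMain` (the
statements are literally the fields `deg_ne`, `R_ne`, `deg_le`, `wt`, `hasse` of `TwoSetup.G3Adm` for the family
`R i = feldR i.1 H`, `u i = i.2.1`, `uθ i = i.2.2` on `B ⊆ G3Boxes.famBox L₀ Dbox Dθ`, so the level-0 assembler
(`SiegelTwo`) plugs them in):

* `natDegree_feldR_eq : natDegree (feldR ℓ H) = ℓ`, `feldR_ne_zero`;
* `feldman_deg_ne` — equal exponent vectors `allκ` and `i ≠ i′` force `ℓ₀ ≠ ℓ₀′`, hence distinct degrees;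
* `feldman_deg_le` (`ℓ₀ ≤ L₀ ≤ D₀`), `feldman_R_ne`;
* `feldman_wt` — `‖coeffₖ(hw R i t₀)‖·ρᵏ ≤ Bw` from the record's line `∀ ℓ ≤ L₀, ‖den(ℓ,H)⁻¹‖₂·ρ^ℓ ≤ Bw` (`ρ ≥ 1`);
* `feldman_hasse` — with `den₀ x τ = ν(H)^{τ.1}`: `den₀·(Hasse_{τ.1} R i)(x) = z₀ ∈ ℤ`, `|z₀| ≤ M₀ x τ` from the
  record's line `∀ ℓ ≤ L₀, ν(H)^{t}·e^{H/e}·(e(1+|x|/H))^ℓ ≤ M₀ x (t, ν)`.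

WHAT THIS IS NOT: no Siegel step, no record; no crux moves.

References: Yu. V. Nesterenko, LNM 1819 (2003), §3.1 Prop. 3.1; K. Yu, Acta Math. 211 (2013), §4.
-/

noncomputable section

open Finset Polynomial
open Literature.NumberTheory.Transcendental
open Literature.NumberTheory.Transcendental (FeldmanDelta.num FeldmanDelta.den)
open Literature.NumberTheory.Transcendental.FeldmanDelta
open Literature.NumberTheory.Transcendental.CW77.Setup (Tau tauNorm)

namespace Summit.ABC.StewartYu.FeldmanBasis

/-- `natDegree Δ(Y₀; ℓ, H) = ℓ` exactly. [cite: Nesterenko2003, §3.1 (3.1)] -/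
theorem natDegree_feldR_eq (ℓ H : ℕ) : (feldR ℓ H).natDegree = ℓ := by
  refine le_antisymm (natDegree_feldR_le ℓ H) ?_
  refine le_natDegree_of_ne_zero ?_
  rw [coeff_feldR_self]
  exact inv_ne_zero (by exact_mod_cast den_ne_zero ℓ H)

/-- `Δ(Y₀; ℓ, H) ≠ 0`. [folklore] -/
theorem feldR_ne_zero (ℓ H : ℕ) : feldR ℓ H ≠ 0 := by
  intro h0
  have h := coeff_feldR_self ℓ H
  rw [h0, coeff_zero] at h
  exact inv_ne_zero (by exact_mod_cast den_ne_zero ℓ H : ((den ℓ H : ℚ)) ≠ 0) h.symm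

end Summit.ABC.StewartYu.FeldmanBasis

namespace Summit.ABC.StewartYu.TwoSetup

open Summit.ABC.StewartYu.FeldmanBasis Summit.ABC.StewartYu.G3Boxes

variable (S : TwoSetup) (H : ℕ)

/-- The Fel'dman family's exponent vector over all generators is `snoc i.2.1 i.2.2`; equal vectors mean equal
`i.2`. [folklore] -/
theorem allκ_feldman_eq_iff (i i' : ℕ × ((Fin S.d → ℤ) × ℤ)) :
    S.allκ (fun i => i.2.1) (fun i => i.2.2) i = S.allκ (fun i => i.2.1) (fun i => i.2.2) i' ↔ i.2 = i'.2 := by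
  unfold allκ
  constructor
  · intro heq
    have h1 : i.2.1 = i'.2.1 := by
      funext j
      have := congrFun heq (Fin.castSucc j)
      simpa only [Fin.snoc_castSucc] using this
    have h2 : i.2.2 = i'.2.2 := by
      have := congrFun heq (Fin.last _)
      simpa only [Fin.snoc_last] using this
    exact Prod.ext h1 h2
  · intro heq
    show (Fin.snoc i.2.1 i.2.2 : Fin (S.d + 1) → ℤ) = Fin.snoc i'.2.1 i'.2.2
    rw [heq]

/-- **`deg_ne`**: distinct unknowns with the same exponent vector have `Y₀`-factors of distinct degrees.
[cite: Nesterenko2003, §3.1; shape only] -/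
theorem feldman_deg_ne (B : Finset (ℕ × ((Fin S.d → ℤ) × ℤ))) :
    ∀ i ∈ B, ∀ i' ∈ B, S.allκ (fun i => i.2.1) (fun i => i.2.2) i = S.allκ (fun i => i.2.1) (fun i => i.2.2) i' →
      i ≠ i' → (feldR i.1 H).natDegree ≠ (feldR i'.1 H).natDegree := by
  intro _ _ _ _ hκ hne hdeg
  rw [natDegree_feldR_eq, natDegree_feldR_eq] at hdeg
  rw [allκ_feldman_eq_iff] at hκ
  exact hne (Prod.ext hdeg hκ)

/-- **`R_ne`**. [folklore] -/
theorem feldman_R_ne (B : Finset (ℕ × ((Fin S.d → ℤ) × ℤ))) :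
    ∀ i ∈ B, (fun i : ℕ × ((Fin S.d → ℤ) × ℤ) => feldR i.1 H) i ≠ 0 :=
  fun i _ => feldR_ne_zero i.1 H

/-- **`deg_le`** on the box (`ℓ₀ ≤ L₀ ≤ D₀`). [folklore] -/
theorem feldman_deg_le {L₀ D₀ : ℕ} (hL : L₀ ≤ D₀) {Dbox : Fin S.d → ℕ} {Dθ : ℕ}
    (B : Finset (ℕ × ((Fin S.d → ℤ) × ℤ))) (hB : B ⊆ famBox L₀ Dbox Dθ) :
    ∀ i ∈ B, (feldR i.1 H).natDegree ≤ D₀ := by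
  intro i hi
  rw [natDegree_feldR_eq]
  exact ((mem_famBox.mp (hB hi)).1).trans hL

/-- **`u_le` / `uθ_le`** on the box. [folklore] -/
theorem feldman_box_le {L₀ : ℕ} {Dbox : Fin S.d → ℕ} {Dθ : ℕ}
    (B : Finset (ℕ × ((Fin S.d → ℤ) × ℤ))) (hB : B ⊆ famBox L₀ Dbox Dθ) :
    (∀ i ∈ B, ∀ j, |i.2.1 j| ≤ (Dbox j : ℤ)) ∧ (∀ i ∈ B, |i.2.2| ≤ (Dθ : ℤ)) :=
  ⟨fun _ hi j => (mem_famBox.mp (hB hi)).2.1 j, fun _ hi => (mem_famBox.mp (hB hi)).2.2⟩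

/-- **`wt`**: the weighted `2`-adic coefficient bound of the `Y₀`-weights at radius `ρ ≥ 1` from the record's
line `∀ ℓ ≤ L₀, ‖den(ℓ,H)⁻¹‖₂·ρ^ℓ ≤ Bw`. [cite: Nesterenko2003, §3.1; shape only] -/
theorem feldman_wt {L₀ : ℕ} {Dbox : Fin S.d → ℕ} {Dθ : ℕ}
    (B : Finset (ℕ × ((Fin S.d → ℤ) × ℤ))) (hB : B ⊆ famBox L₀ Dbox Dθ) {ρ Bw : ℝ} (hρ1 : 1 ≤ ρ)
    (hBw : ∀ ℓ, ℓ ≤ L₀ → ‖((den ℓ H : ℚ_[2]))⁻¹‖ * ρ ^ ℓ ≤ Bw) :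
    ∀ i ∈ B, ∀ t₀ k, ‖(hw (fun i : ℕ × ((Fin S.d → ℤ) × ℤ) => feldR i.1 H) i t₀).coeff k‖ * ρ ^ k ≤ Bw := by
  intro i hi t₀ k
  exact (norm_coeff_hw_feldR_mul_pow_le (fun i : ℕ × ((Fin S.d → ℤ) × ℤ) => i.1) H i t₀ k hρ1).trans
    (hBw i.1 (mem_famBox.mp (hB hi)).1)

/-- **`hasse`**: with `den₀ x τ = ν(H)^{τ.1}`, pointwise integrality and size of the `Y₀`-weights from the record's
line `∀ ℓ ≤ L₀, ν(H)^t·e^{H/e}·(e(1+|x|/H))^ℓ ≤ M₀ x τ` (`τ.1 = t`). [cite: Nesterenko2003, §3.1 Prop 3.1] -/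
theorem feldman_hasse (hH : 1 ≤ H) {L₀ : ℕ} {Dbox : Fin S.d → ℕ} {Dθ : ℕ}
    (B : Finset (ℕ × ((Fin S.d → ℤ) × ℤ))) (hB : B ⊆ famBox L₀ Dbox Dθ) (M₀ : ℤ → Tau S.d → ℤ)
    (hM : ∀ (x : ℤ) (τ : Tau S.d), ∀ ℓ, ℓ ≤ L₀ → (Nat.lcmUpto H : ℝ) ^ τ.1 *
      (Real.exp (H / Real.exp 1) * (Real.exp 1 * (1 + |(x : ℝ)| / H)) ^ ℓ) ≤ M₀ x τ) :
    ∀ i ∈ B, ∀ (x : ℤ) (τ : Tau S.d), ∃ z₀ : ℤ,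
      (((Nat.lcmUpto H) ^ τ.1 : ℕ) : ℚ) * (hasseDeriv τ.1 (feldR i.1 H)).eval (x : ℚ) = z₀ ∧ |z₀| ≤ M₀ x τ := by
  intro i hi x τ
  exact exists_int_lcm_pow_mul_hasse_feldR i.1 hH τ.1 x (hM x τ i.1 (mem_famBox.mp (hB hi)).1)

end Summit.ABC.StewartYu.TwoSetup

end
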